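import Mathlib
import HarnessLib
import Summits.HubbardSuperconductivity.HubbardSuperconductivity.Theorems.KLProgrammeKLRegimeFatMultiplierIncrementSampledTime
import Summits.HubbardSuperconductivity.HubbardSuperconductivity.Theorems.KLProgrammeKLRegimeFatMultiplierPackThird

/-!
# Route `KLProgramme` — crux K3 ENGINE (stmt-HubbardSuperconductivity-20437) stub (b) conj. 2, cure «(c-D)² FAMILY TELESCOPE», brick (D2b-instance, TIME):
# the fat multiplier INCREMENT pair `(F̃^{K′}_ω − F̃^{K}_ω)·F̃^{K}_{ω′}` as a sampled increment symbol — its first three TIME (Matsubara) differences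

Cell `gate-hubbard-kl`, seat hubbard-kl-k3c3-p2 (g10); (R68c) EARLY-GO; companion of `…FatMultiplierIncrementPairSpace`.  Along the time line the co-factor
`Q(k₀,p) = G_{m₁}(k₀²+e_K(p)²)·Z(p)` has the GLOBAL line bounds of `abs_{deriv,iteratedDeriv_two,iteratedDeriv_three}_symbol_timeLine_le` (`z = Z(p)`, `|z| ≤ 1`):
`qt₁ = 2g₁|h₀|/Λ`, `qt₂ = (4g₂+2g₁)h₀²/Λ²`, `qt₃ = (8g₃+12g₂)|h₀|³/Λ³` (`g = (de₀², de₀⁴, de₀⁶)`, `h₀ = 2π/β`); the generic layer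
`…FatMultiplierIncrementSampledTime.norm_fwdDiff_iter_time_incrSymbol_le` then gives, under the frequency window `Λ_{m₁}β < π(2M−5)` (`symbol_window₃`):

* **`norm_fwdDiff_iter_time_fatIncrPair_le`** — `‖Δ_{(1,0)} Gs^Δ‖ ≤ 𝔅ᵗ₁·1 + 𝔅ᵗ₀qt₁`, `‖Δ²‖ ≤ 𝔅ᵗ₂ + 2𝔅ᵗ₁qt₁ + 𝔅ᵗ₀qt₂`, `‖Δ³‖ ≤ 𝔅ᵗ₃ + 3𝔅ᵗ₂qt₁ + 3𝔅ᵗ₁qt₂ + 𝔅ᵗ₀qt₃`,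
  `𝔅ᵗ₀ = C₁W₀`, `𝔅ᵗ₁ = C₂W₀D₁`, `𝔅ᵗ₂ = C₃W₀D₁² + C₂W₀D₂`, `𝔅ᵗ₃ = C₄W₀D₁³ + 3C₃W₀D₁D₂`, `D₁ = 2Λ|h₀|`, `D₂ = 2h₀²`, `W₀ = N₀(2(Λ+N₀)+N₀)` — every monomial carries `N₀`
  (the sup of the piece).

Everything is proved; no definitions, no sorry.  Nothing asserts superconductivity. [cite: BenfattoGiulianiMastropietro2006, §2.5 Lemma 2.2 (2.52), (2.56), §3 (3.2)]
-/

noncomputable section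

namespace Summit.HubbardSuperconductivity.HubbardSuperconductivity.Theorems.TorusFourierL2

set_option linter.dupNamespace false -- summit = problem name (single-conjunct summit), D-0017

open Set Finset Filter Topology Literature.MathematicalPhysics.QuantumLattice Literature.MathematicalPhysics.QuantumLattice.BandSectorCounting
open Literature.MathematicalPhysics.QuantumLattice.FermiRG Literature.Probability.LatticeModels Literature.Analysis.SpecialFunctions Literature.Analysis.Calculus
open Summit.HubbardSuperconductivity.HubbardSuperconductivity.Theorems.DispersionFlow
open Summit.HubbardSuperconductivity.HubbardSuperconductivity.Theorems.KLRegimeSplit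
open Summit.HubbardSuperconductivity.HubbardSuperconductivity.Theorems.KLProgrammeLegKernels
open Summit.HubbardSuperconductivity.HubbardSuperconductivity.Theorems.PerturbedFermiCurve
open scoped Real Nat

section FatIncrPairTime

variable {L M : ℕ} [NeZero L] [NeZero M] {K : TrigPolyC4v}
  {μ e₀ z β : ℝ} (he : 0 < e₀) (hβ : 0 < β)
  (m₁ : ℕ) {n : ℕ} {S₁ S₂ : Finset ℕ} (hS₁ : S₁ ⊆ range (sectorCount n)) (hS₂ : S₂ ⊆ range (sectorCount n))
  {d : ℝ} (hd1 : ∀ u, |deriv (bgmCutoffSq e₀) u| ≤ d) (hd2 : ∀ u, |iteratedDeriv 2 (bgmCutoffSq e₀) u| ≤ d)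
  (hd3 : ∀ u, |iteratedDeriv 3 (bgmCutoffSq e₀) u| ≤ d) (hd4 : ∀ u, |iteratedDeriv 4 (bgmCutoffSq e₀) u| ≤ d)
  {Z : (Fin 2 → ℝ) → ℝ}
  (hZ : ∀ p, Z p = gnCutoff ((π + z) ^ 2 / π ^ 2) ((π + z) ^ 2) (p 0 ^ 2) * gnCutoff ((π + z) ^ 2 / π ^ 2) ((π + z) ^ 2) (p 1 ^ 2) *
    ((radialCutoffC (1 / 2) (momToComplex p) * ∑ a' ∈ S₁, sectorWeightCirc n ((a' : ℕ) : ℤ) (polarAngle p)) *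
      (radialCutoffC (1 / 2) (momToComplex p) * ∑ b' ∈ S₂, sectorWeightCirc n ((b' : ℕ) : ℤ) (polarAngle p))))
  {ν : (Fin 2 → ℝ) → ℝ} {N₀ : ℝ} (hN₀ : ∀ p, |ν p| ≤ N₀)
  {Φ : ℝ × (Fin 2 → ℝ) → ℂ}
  (hΦ : ∀ k₀ p, Φ (k₀, p) = (((bgmCutoffSq e₀ ((16 : ℝ) ^ m₁ * (k₀ ^ 2 + (frameLevel μ K (WithLp.toLp 2 p) - ν p) ^ 2)) -
      bgmCutoffSq e₀ ((16 : ℝ) ^ m₁ * (k₀ ^ 2 + frameLevel μ K (WithLp.toLp 2 p) ^ 2))) *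
      (bgmCutoffSq e₀ ((16 : ℝ) ^ m₁ * (k₀ ^ 2 + frameLevel μ K (WithLp.toLp 2 p) ^ 2)) * Z p) : ℝ) : ℂ))
  {Gs : TorusSite 1 (2 * M) × TorusSite 2 L → ℂ}
  (hGsΦ : ∀ q, Gs q = Φ (π * (1 - 2 * M) / β + 2 * π / β * (((q.1 0).val : ℕ) : ℝ), fun j => 2 * π / L * (((q.2 j).valMinAbs : ℤ) : ℝ)))

include he hβ hS₁ hS₂ hd1 hd2 hd3 hd4 hZ hN₀ hΦ hGsΦ in
set_option maxHeartbeats 1600000 in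
/-- **Time differences of the sampled fat increment pair, orders 1–3** (see the module docstring; constants as abbreviation hypotheses, instantiate with
`rfl`), under the frequency window `Λ_{m₁}β < π(2M − 5)`. [cite: BenfattoGiulianiMastropietro2006, §2.5 Lemma 2.2 (2.52), (2.56), §3 (3.2)] -/
theorem norm_fwdDiff_iter_time_fatIncrPair_le (hM : klScale e₀ m₁ * β < π * (2 * M - 5))
    {qt₁ qt₂ qt₃ E₀ C₁ C₂ C₃ C₄ D₁ D₂ W₀ B₀ B₁ B₂ B₃ : ℝ}
    (hqt₁ : qt₁ = 2 * (d * e₀ ^ 2) * |2 * π / β| / klScale e₀ m₁) (hqt₂ : qt₂ = (4 * (d * e₀ ^ 4) + 2 * (d * e₀ ^ 2)) * (2 * π / β) ^ 2 / klScale e₀ m₁ ^ 2)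
    (hqt₃ : qt₃ = (8 * (d * e₀ ^ 6) + 12 * (d * e₀ ^ 4)) * |2 * π / β| ^ 3 / klScale e₀ m₁ ^ 3)
    (hE₀ : E₀ = klScale e₀ m₁ + N₀)
    (hC₁ : C₁ = d * e₀ ^ 2 / klScale e₀ m₁ ^ 2) (hC₂ : C₂ = d * e₀ ^ 4 / klScale e₀ m₁ ^ 4) (hC₃ : C₃ = d * e₀ ^ 6 / klScale e₀ m₁ ^ 6)
    (hC₄ : C₄ = d * e₀ ^ 8 / klScale e₀ m₁ ^ 8) (hD₁ : D₁ = 2 * klScale e₀ m₁ * |2 * π / β|) (hD₂ : D₂ = 2 * (2 * π / β) ^ 2)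
    (hW₀ : W₀ = N₀ * (2 * E₀ + N₀))
    (hB₀ : B₀ = C₁ * W₀) (hB₁ : B₁ = C₂ * W₀ * D₁) (hB₂ : B₂ = C₃ * W₀ * D₁ ^ 2 + C₂ * W₀ * D₂) (hB₃ : B₃ = C₄ * W₀ * D₁ ^ 3 + 3 * (C₃ * W₀ * (D₁ * D₂)))
    (q : TorusSite 1 (2 * M) × TorusSite 2 L) :
    ‖(fwdDiff ((fun _ : Fin 1 => (1 : ZMod (2 * M))), (0 : TorusSite 2 L))) Gs q‖ ≤ B₁ * 1 + B₀ * qt₁ ∧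
    ‖((fwdDiff ((fun _ : Fin 1 => (1 : ZMod (2 * M))), (0 : TorusSite 2 L)))^[2] Gs) q‖ ≤ B₂ * 1 + 2 * (B₁ * qt₁) + B₀ * qt₂ ∧
    ‖((fwdDiff ((fun _ : Fin 1 => (1 : ZMod (2 * M))), (0 : TorusSite 2 L)))^[3] Gs) q‖ ≤ B₃ * 1 + 3 * (B₂ * qt₁) + 3 * (B₁ * qt₂) + B₀ * qt₃ := by
  have hΛ : 0 < klScale e₀ m₁ := by rw [klScale]; positivity
  have hd0 : 0 ≤ d := (abs_nonneg _).trans (hd1 0)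
  set eK : (Fin 2 → ℝ) → ℝ := fun p => frameLevel μ K (WithLp.toLp 2 p) with heK
  set G : ℝ → ℝ := fun v => bgmCutoffSq e₀ ((16 : ℝ) ^ m₁ * v) with hGdef
  obtain ⟨hGc, hG0, hG1, hG2, hG3, hGv⟩ := scaleProfile_bounds₃ he m₁ hd1 hd2 hd3
  have hGc2 : ContDiff ℝ 2 G := hGc.of_le (by norm_num)
  have hZ0 : ∀ p, |Z p| ≤ 1 := abs_fatAngular_le_one hZ hS₁ hS₂
  set Q : ℝ × (Fin 2 → ℝ) → ℝ := fun kp => G (kp.1 ^ 2 + eK kp.2 ^ 2) * Z kp.2 with hQdef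
  have hQline : ∀ (k₀ : ℝ) (p : Fin 2 → ℝ), (fun s : ℝ => Q (k₀ + s * (2 * π / β), p)) =
      fun s => G ((k₀ + s * (2 * π / β)) ^ 2 + eK p ^ 2) * Z p := by
    intro k₀ p; funext s; simp only [hQdef]
  have hQC : ∀ (k₀ : ℝ) (p : Fin 2 → ℝ), ContDiff ℝ 3 (fun s : ℝ => Q (k₀ + s * (2 * π / β), p)) := by
    intro k₀ p; rw [hQline]; exact contDiff_three_symbol_timeLine hGc (eK p ^ 2) k₀ (2 * π / β) (Z p)
  have hq₁0 : 0 ≤ qt₁ := by rw [hqt₁]; positivity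
  have hq₂0 : 0 ≤ qt₂ := by rw [hqt₂]; positivity
  have hq₃0 : 0 ≤ qt₃ := by rw [hqt₃]; positivity
  have hQ0 : ∀ k₀ p, |Q (k₀, p)| ≤ 1 := fun k₀ p => by
    simp only [hQdef]; rw [abs_mul]
    calc |G (k₀ ^ 2 + eK p ^ 2)| * |Z p| ≤ 1 * 1 := mul_le_mul (hG0 _) (hZ0 p) (abs_nonneg _) zero_le_one
      _ = 1 := one_mul _
  have hQ1 : ∀ (k₀ : ℝ) (p : Fin 2 → ℝ) (s : ℝ), (∀ i, |p i| ≤ π) → |eK p| ≤ klScale e₀ m₁ + N₀ → |k₀ + s * (2 * π / β)| ≤ klScale e₀ m₁ →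
      |deriv (fun s : ℝ => Q (k₀ + s * (2 * π / β), p)) s| ≤ qt₁ := by
    intro k₀ p s _ _ _
    rw [hQline]
    have h := abs_deriv_symbol_timeLine_le hGc2 hΛ (by positivity) hG1 hGv (sq_nonneg (eK p)) k₀ (2 * π / β) (Z p) s
    refine h.trans ?_
    rw [hqt₁]
    have hz := hZ0 p
    have h1 : 2 * (d * e₀ ^ 2) * |2 * π / β| * |Z p| / klScale e₀ m₁ ≤ 2 * (d * e₀ ^ 2) * |2 * π / β| * 1 / klScale e₀ m₁ := by
      gcongr
    simpa using h1
  have hQ2 : ∀ (k₀ : ℝ) (p : Fin 2 → ℝ) (s : ℝ), (∀ i, |p i| ≤ π) → |eK p| ≤ klScale e₀ m₁ + N₀ → |k₀ + s * (2 * π / β)| ≤ klScale e₀ m₁ →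
      |iteratedDeriv 2 (fun s : ℝ => Q (k₀ + s * (2 * π / β), p)) s| ≤ qt₂ := by
    intro k₀ p s _ _ _
    rw [hQline]
    have h := abs_iteratedDeriv_two_symbol_timeLine_le hGc2 hΛ (by positivity) (by positivity) hG1 hG2 hGv (sq_nonneg (eK p)) k₀ (2 * π / β) (Z p) s
    refine h.trans ?_
    rw [hqt₂]
    have hz := hZ0 p
    have h1 : (4 * (d * e₀ ^ 4) + 2 * (d * e₀ ^ 2)) * (2 * π / β) ^ 2 * |Z p| / klScale e₀ m₁ ^ 2 ≤
        (4 * (d * e₀ ^ 4) + 2 * (d * e₀ ^ 2)) * (2 * π / β) ^ 2 * 1 / klScale e₀ m₁ ^ 2 := by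
      gcongr
    simpa using h1
  have hQ3 : ∀ (k₀ : ℝ) (p : Fin 2 → ℝ) (s : ℝ), (∀ i, |p i| ≤ π) → |eK p| ≤ klScale e₀ m₁ + N₀ → |k₀ + s * (2 * π / β)| ≤ klScale e₀ m₁ →
      |iteratedDeriv 3 (fun s : ℝ => Q (k₀ + s * (2 * π / β), p)) s| ≤ qt₃ := by
    intro k₀ p s _ _ _
    rw [hQline]
    have h := abs_iteratedDeriv_three_symbol_timeLine_le hGc hΛ (by positivity) (by positivity) (by positivity) hG1 hG2 hG3 hGv (sq_nonneg (eK p)) k₀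
      (2 * π / β) (Z p) s
    refine h.trans ?_
    rw [hqt₃]
    have hz := hZ0 p
    have h1 : (8 * (d * e₀ ^ 6) + 12 * (d * e₀ ^ 4)) * |2 * π / β| ^ 3 * |Z p| / klScale e₀ m₁ ^ 3 ≤
        (8 * (d * e₀ ^ 6) + 12 * (d * e₀ ^ 4)) * |2 * π / β| ^ 3 * 1 / klScale e₀ m₁ ^ 3 := by
      gcongr
    simpa using h1
  have hΦ' : ∀ k₀ p, Φ (k₀, p) = (((bgmCutoffSq e₀ ((16 : ℝ) ^ m₁ * (k₀ ^ 2 + (eK p - ν p) ^ 2)) -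
      bgmCutoffSq e₀ ((16 : ℝ) ^ m₁ * (k₀ ^ 2 + eK p ^ 2))) * Q (k₀, p) : ℝ) : ℂ) := fun k₀ p => by
    simp only [hΦ, hQdef, hGdef, heK]
  have hwin : ∀ mm : ℤ, (mm < 3 ∨ ((2 * M : ℕ) : ℤ) ≤ mm + 3) → klScale e₀ m₁ < |π * (1 - 2 * M) / β + 2 * π / β * (mm : ℝ)| :=
    fun mm hmm => symbol_window₃ hβ hM mm hmm
  have hL : (0 : ℝ) < L := Nat.cast_pos.2 (Nat.pos_of_ne_zero (NeZero.ne L))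
  have hxL : |2 * π / (L : ℝ)| * L = 2 * π := by rw [abs_of_pos (by positivity)]; field_simp
  have h := norm_fwdDiff_iter_time_incrSymbol_le (P := 2 * M) he m₁ hd1 hd2 hd3 hd4 eK ν hN₀ (2 * π / β) Q hQC zero_le_one hq₁0 hq₂0 hq₃0 hQ0
    hQ1 hQ2 hQ3 Φ hΦ' (π * (1 - 2 * M) / β) (2 * π / L) hwin hxL Gs hGsΦ hE₀ hC₁ hC₂ hC₃ hC₄ hD₁ hD₂ hW₀ hB₀ hB₁ hB₂ hB₃ q
  exact h

end FatIncrPairTime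

end Summit.HubbardSuperconductivity.HubbardSuperconductivity.Theorems.TorusFourierL2

end
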